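import Mathlib
import HarnessLib
import Summits.CriticalPhenomena.PercolationContinuityZ3.Theorems.PercNearOneGluingNoHeavyLowerTailKnQuestion8AntitheticRoutingDefs
import Summits.CriticalPhenomena.PercolationContinuityZ3.Theorems.PercNearOneGluingNoHeavyLowerTailKnQuestion8AntitheticRoutingHub
import Summits.CriticalPhenomena.PercolationContinuityZ3.Theorems.PercNearOneGluingNoHeavyLowerTailKnQuestion8AntitheticRoutingNeck

/-!
# `NoHeavyLowerTail` (crux stmt-CriticalPhenomena-4575), antithetic vdBHK programme: the routing-lemma induction assembled
# (PROOF-RL-g43 P5, abstractly): every leg structure generated from the 2-chain by HUBs and NECKs is natural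

Support file (seat `prim-ineq-gen-7` gen 43; `--supports stmt-CriticalPhenomena-4575`).  No `sorry`.  Defines the SHAPES of rooted forests
(`AntitheticForestShape`: `nil` = empty forest, `cons s r` = a first tree `g + s` next to the forest `r`), their label types and leg structures
(`labelType`, `strOf`: `strOf nil = leafStr`, `strOf (cons s r) = neck (hub (strOf s)) (strOf r)` — PROOF-RL P1″), and proves
* `AntitheticLegStr.inv_hub`, `inv_neck` — the reflexivity axioms of PROOF-RL P1′ are preserved by the constructors;
* `AntitheticForestShape.natural_strOf` — **every generated leg structure satisfies (♮)** (induction with `natural_leaf`, `natural_hub`, `natural_neck`).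
By PROOF-RL P1/P1″ (pencil, machine-checked) the colouring poset `F_v(f+E)` of a leg with forest `E` of shape `F` is (isomorphic to) the two-level poset of
`strOf F`; with P2 ((♮) ⟹ RL) and the Lean theorems `rl_product`, `typed_point` this is the routing lemma and `(***)⁺⁺` for every rooted tree.
-/

namespace Summit.CriticalPhenomena.PercolationContinuityZ3.Theorems

namespace AntitheticLegStr

/-- The axioms of PROOF-RL P1′ used by the hub and neck lemmas: reflexive cube/bottom/top orders, a sub-colouring's bottom lies below the
colouring's top, and `b < Φ(b)`. [this work] -/
def Inv {Λ : Type*} (S : AntitheticLegStr Λ) : Prop :=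
  (∀ x, S.sub x x) ∧ (∀ x, S.ble x x) ∧ (∀ x, S.tle x x) ∧ (∀ x x', S.sub x' x → S.blt x' x) ∧ (∀ x, S.blt x (S.Φ x))

/-- The 2-chain satisfies the axioms. [this work] -/
theorem inv_leaf : leafStr.Inv := by
  refine ⟨?_, ?_, ?_, ?_, ?_⟩ <;> intros <;> trivial

/-- The axioms are preserved by the HUB constructor. [this work] -/
theorem inv_hub {Λ : Type*} (S : AntitheticLegStr Λ) (h : S.Inv) : (hub S).Inv := by
  obtain ⟨h1, h2, h3, h4, h5⟩ := h
  refine ⟨?_, ?_, ?_, ?_, ?_⟩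
  · rintro ⟨c, x⟩; cases c <;> simp [hub, h1]
  · rintro ⟨c, x⟩; cases c <;> simp [hub, h1, h2]
  · rintro ⟨c, x⟩; cases c <;> simp [hub, h1, h3]
  · rintro ⟨c, x⟩ ⟨c', x'⟩ hs
    cases c <;> cases c' <;> simp [hub] at hs ⊢ <;> exact hs
  · rintro ⟨c, x⟩; cases c <;> simp [hub, h1, h5]

/-- The axioms are preserved by the NECK constructor. [this work] -/
theorem inv_neck {Λ₁ Λ₂ : Type*} (S₁ : AntitheticLegStr Λ₁) (S₂ : AntitheticLegStr Λ₂) (g₁ : S₁.Inv) (g₂ : S₂.Inv) :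
    (neck S₁ S₂).Inv := by
  obtain ⟨a1, a2, a3, a4, a5⟩ := g₁
  obtain ⟨b1, b2, b3, b4, b5⟩ := g₂
  refine ⟨?_, ?_, ?_, ?_, ?_⟩
  · rintro ⟨x, y⟩; exact ⟨a1 x, b1 y⟩
  · rintro ⟨x, y⟩; exact ⟨a2 x, b2 y⟩
  · rintro ⟨x, y⟩; exact ⟨a3 x, b3 y⟩
  · rintro ⟨x, y⟩ ⟨x', y'⟩ ⟨hx, hy⟩; exact ⟨a4 x x' hx, b4 y y' hy⟩
  · rintro ⟨x, y⟩; exact ⟨a5 x, b5 y⟩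

end AntitheticLegStr

/-- Shapes of rooted forests below the lower end `w` of the root edge: `nil` = no edge; `cons s r` = a first edge `g` at `w` carrying the forest of shape `s`
below it, next to the remaining forest of shape `r` at `w` (PROOF-RL P1″: every leg `f + E` has such a shape). [this work] -/
inductive AntitheticForestShape : Type
  | nil : AntitheticForestShape
  | cons : AntitheticForestShape → AntitheticForestShape → AntitheticForestShape

namespace AntitheticForestShape

/-- The label type of a shape (`Unit` for the empty forest; `(Bool × labels of s) × labels of r` for `cons s r`). [this work] -/
def labelType : AntitheticForestShape → Type
  | nil => Unit
  | cons s r => (Bool × labelType s) × labelType r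

/-- `labelType F` is a finite type. [this work] -/
instance instFintypeLabelType : (F : AntitheticForestShape) → Fintype (labelType F)
  | nil => inferInstanceAs (Fintype Unit)
  | cons s r =>
      haveI : Fintype (labelType s) := instFintypeLabelType s
      haveI : Fintype (labelType r) := instFintypeLabelType r
      inferInstanceAs (Fintype ((Bool × labelType s) × labelType r))

/-- `labelType F` has decidable equality. [this work] -/
instance instDecEqLabelType : (F : AntitheticForestShape) → DecidableEq (labelType F)
  | nil => inferInstanceAs (DecidableEq Unit)
  | cons s r =>
      haveI : DecidableEq (labelType s) := instDecEqLabelType s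
      haveI : DecidableEq (labelType r) := instDecEqLabelType r
      inferInstanceAs (DecidableEq ((Bool × labelType s) × labelType r))

/-- The leg structure of a shape: `leafStr` for `nil`, `neck (hub (strOf s)) (strOf r)` for `cons s r` (PROOF-RL P1″). [this work] -/
def strOf : (F : AntitheticForestShape) → AntitheticLegStr (labelType F)
  | nil => AntitheticLegStr.leafStr
  | cons s r => AntitheticLegStr.neck (AntitheticLegStr.hub (strOf s)) (strOf r)

/-- Every generated structure satisfies the axioms of PROOF-RL P1′. [this work] -/
theorem inv_strOf : ∀ F : AntitheticForestShape, (strOf F).Inv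
  | nil => AntitheticLegStr.inv_leaf
  | cons s r => AntitheticLegStr.inv_neck _ _ (AntitheticLegStr.inv_hub _ (inv_strOf s)) (inv_strOf r)

/-- **THE ROUTING-LEMMA INDUCTION (PROOF-RL-g43 P5, abstract form).**  Every leg structure generated from the 2-chain by HUBs and NECKs satisfies the
strengthened routing statement (♮). [this work] -/
theorem natural_strOf : ∀ F : AntitheticForestShape, (strOf F).Natural
  | nil => AntitheticLegStr.natural_leaf
  | cons s r => by
      have hs := natural_strOf s
      have hr := natural_strOf r
      obtain ⟨s1, -, -, s4, -⟩ := inv_strOf s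
      have hhub := AntitheticLegStr.natural_hub (strOf s) s1 (fun x => s4 x x (s1 x)) hs
      obtain ⟨c1, c2, c3, c4, -⟩ := AntitheticLegStr.inv_hub _ (inv_strOf s)
      obtain ⟨-, d2, d3, -, d5⟩ := inv_strOf r
      exact AntitheticLegStr.natural_neck _ _ c1 c2 c3 d2 d3 c4 d5 hhub hr

end AntitheticForestShape

end Summit.CriticalPhenomena.PercolationContinuityZ3.Theorems
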